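import Literature.Combinatorics.SimpleGraph.HamiltonianPathSegments
import Mathlib.Data.List.Chain
import HarnessLib

/-!
# Expansion of a vertex list by gadget traversals, and the two round trips with contraction

Continuation of `HamiltonianPathSegments.lean` (segments `IsSeg VX l a xs b`, contraction
`contract VX l`), for the gadget substitution theorem (`HamiltonianGadgetSubstitution.lean`;
local replacement, Garey–Johnson 1979, §3.2.2):

* `expand ι l` — insert the list `ι a b` between any two consecutive entries `a, b` of `l`;
* `contract_expand` — contracting an expansion by lists inside `VX` gives back the list;
* `expand_contract` — expanding the contraction of `l'` by the segments of `l'` gives back `l'`;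
* `mem_expand_iff`, `nodup_expand`, `isChain_expand`, `expand_eq_append_of_infix` (an occurrence
  of `a, b` in `l` splits the expansion around `a, ι a b, b`), `isSeg_expand_iff` (the segments of
  an expansion are exactly the inserted nonempty lists).

## References

* M. R. Garey, D. S. Johnson, *Computers and Intractability*, Freeman 1979, §3.2.2.
-/

namespace Literature.Combinatorics.SimpleGraph

variable {α : Type*}

/-- **Expansion**: insert `ι a b` between any two consecutive entries `a, b`.
[cite: GareyJohnson1979, §3.2.2 (local replacement)] -/
def expand (ι : α → α → List α) : List α → List α
  | [] => []
  | [a] => [a]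
  | a :: b :: l => a :: (ι a b ++ expand ι (b :: l))

section expand

variable (ι : α → α → List α)

/-- Expansion of a two-entry prefix. [folklore] -/
@[simp] theorem expand_cons_cons (a b : α) (l : List α) :
    expand ι (a :: b :: l) = a :: (ι a b ++ expand ι (b :: l)) := rfl

/-- Expansion of a singleton. [folklore] -/
@[simp] theorem expand_singleton (a : α) : expand ι [a] = [a] := rfl

/-- Expansion of the empty list. [folklore] -/
@[simp] theorem expand_nil : expand ι ([] : List α) = [] := rfl

/-- The first entry of an expansion. [folklore] -/
theorem head?_expand (l : List α) : (expand ι l).head? = l.head? := by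
  rcases l with _ | ⟨a, _ | ⟨b, l⟩⟩ <;> simp

/-- An expansion of a nonempty list is nonempty. [folklore] -/
theorem expand_ne_nil {l : List α} (h : l ≠ []) : expand ι l ≠ [] := by
  rcases l with _ | ⟨a, _ | ⟨b, l⟩⟩ <;> simp_all

/-- The last entry of an expansion. [folklore] -/
theorem getLast?_expand : ∀ l : List α, (expand ι l).getLast? = l.getLast?
  | [] => rfl
  | [a] => rfl
  | a :: b :: l => by
    have hne : expand ι (b :: l) ≠ [] := expand_ne_nil ι (List.cons_ne_nil b l)
    rw [expand_cons_cons, ← List.cons_append, List.getLast?_append_of_ne_nil _ hne,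
      getLast?_expand (b :: l), List.getLast?_cons_cons]

/-- **The entries of an expansion**: the entries of `l` and of the inserted lists. [folklore] -/
theorem mem_expand_iff {x : α} : ∀ {l : List α},
    x ∈ expand ι l ↔ x ∈ l ∨ ∃ a b, [a, b] <:+: l ∧ x ∈ ι a b
  | [] => by simp
  | [a] => by
    simp only [expand_singleton, List.mem_singleton]
    constructor
    · exact Or.inl
    · rintro (h | ⟨c, d, hcd, -⟩)
      · exact h
      · have := hcd.length_le
        simp at this
  | a :: b :: l => by
    rw [expand_cons_cons, List.mem_cons, List.mem_append, mem_expand_iff]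
    constructor
    · rintro (rfl | h | h | ⟨c, d, hcd, hx⟩)
      · exact Or.inl List.mem_cons_self
      · exact Or.inr ⟨a, b, ⟨[], l, rfl⟩, h⟩
      · exact Or.inl (List.mem_cons_of_mem _ h)
      · obtain ⟨s, t, hst⟩ := hcd
        exact Or.inr ⟨c, d, ⟨a :: s, t, by rw [← hst]; simp⟩, hx⟩
    · rintro (h | ⟨c, d, ⟨s, t, hst⟩, hx⟩)
      · rcases List.mem_cons.1 h with rfl | h
        · exact Or.inl rfl
        · exact Or.inr (Or.inr (Or.inl h))
      · rcases s with _ | ⟨e, s⟩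
        · simp only [List.nil_append, List.cons_append, List.cons.injEq] at hst
          obtain ⟨rfl, rfl, -⟩ := hst
          exact Or.inr (Or.inl hx)
        · simp only [List.cons_append, List.cons.injEq] at hst
          obtain ⟨rfl, hst⟩ := hst
          exact Or.inr (Or.inr (Or.inr ⟨c, d, ⟨s, t, hst⟩, hx⟩))

/-- **An expansion is a chain** when every inserted piece `a, ι a b, b` is. [folklore] -/
theorem isChain_expand {R : α → α → Prop} : ∀ {l : List α},
    (∀ a b, [a, b] <:+: l → List.IsChain R (a :: (ι a b ++ [b]))) → List.IsChain R (expand ι l)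
  | [], _ => List.IsChain.nil
  | [a], _ => List.isChain_singleton a
  | a :: b :: l, h => by
    rw [expand_cons_cons]
    have hab := h a b ⟨[], l, rfl⟩
    have ih : List.IsChain R (expand ι (b :: l)) :=
      isChain_expand fun c d ⟨s, t, hst⟩ => h c d ⟨a :: s, t, by rw [← hst]; simp⟩
    -- `expand ι (b :: l) = b :: rest`
    obtain ⟨rest, hrest⟩ : ∃ rest, expand ι (b :: l) = b :: rest := by
      rcases l with _ | ⟨c, l⟩
      · exact ⟨[], rfl⟩
      · exact ⟨ι b c ++ expand ι (c :: l), rfl⟩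
    rw [hrest] at ih ⊢
    have : a :: (ι a b ++ b :: rest) = (a :: ι a b) ++ [b] ++ rest := by simp
    rw [this]
    exact List.IsChain.append_overlap (by simpa using hab) ih (List.cons_ne_nil b [])

/-- **An occurrence of `a, b` splits the expansion** around the piece `a, ι a b, b`. [folklore] -/
theorem expand_eq_append_of_infix : ∀ {l : List α} {a b : α}, [a, b] <:+: l →
    ∃ E₁ E₂, expand ι l = E₁ ++ a :: (ι a b ++ b :: E₂) ∧
      (∀ x ∈ E₁, x ∈ l ∨ ∃ c d, [c, d] <:+: l ∧ x ∈ ι c d)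
  | [], _, _, h => by have := h.length_le; simp at this
  | [c], _, _, h => by have := h.length_le; simp at this
  | c :: d :: l, a, b, ⟨[], t, hst⟩ => by
    simp only [List.nil_append, List.cons_append, List.cons.injEq] at hst
    obtain ⟨rfl, rfl, rfl⟩ := hst
    obtain ⟨rest, hrest⟩ : ∃ rest, expand ι (b :: t) = b :: rest := by
      rcases t with _ | ⟨c, t⟩
      · exact ⟨[], rfl⟩
      · exact ⟨ι b c ++ expand ι (c :: t), rfl⟩
    exact ⟨[], rest, by rw [expand_cons_cons, hrest]; rfl, by simp⟩
  | c :: d :: l, a, b, ⟨e :: s, t, hst⟩ => by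
    have hst' : s ++ [a, b] ++ t = d :: l := by
      simp only [List.cons_append, List.cons.injEq] at hst
      simpa using hst.2
    obtain ⟨E₁, E₂, hE, hE₁⟩ := expand_eq_append_of_infix (l := d :: l) ⟨s, t, hst'⟩
    refine ⟨c :: (ι c d ++ E₁), E₂, by rw [expand_cons_cons, hE]; simp, ?_⟩
    intro x hx
    simp only [List.mem_cons, List.mem_append] at hx
    rcases hx with rfl | hx | hx
    · exact Or.inl List.mem_cons_self
    · exact Or.inr ⟨c, d, ⟨[], l, rfl⟩, hx⟩
    · rcases hE₁ x hx with h | ⟨c', d', ⟨s', t', hst'⟩, h⟩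
      · exact Or.inl (List.mem_cons_of_mem _ h)
      · exact Or.inr ⟨c', d', ⟨c :: s', t', by rw [← hst']; simp⟩, h⟩

end expand

/-! ### Contracting an expansion -/

section rounds

variable [DecidableEq α] {VX : Finset α} {ι : α → α → List α}

/-- **Round trip 1**: contracting the expansion of a list outside `VX` by lists inside `VX`
gives back the list. [folklore] -/
theorem contract_expand (hι : ∀ a b, ∀ x ∈ ι a b, x ∈ VX) :
    ∀ {l : List α}, (∀ x ∈ l, x ∉ VX) → contract VX (expand ι l) = l
  | [], _ => rfl
  | [a], h => by rw [expand_singleton, contract_cons_of_not_mem (h a (by simp)), contract_nil]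
  | a :: b :: l, h => by
    have ha : a ∉ VX := h a (by simp)
    have ih := contract_expand hι (l := b :: l) (fun x hx => h x (List.mem_cons_of_mem _ hx))
    rw [expand_cons_cons, contract_cons_of_not_mem ha, contract_append, contract_eq_nil_of_forall (hι a b),
      ih, List.nil_append]

/-- Consecutive entries outside `VX` of such an expansion are consecutive in the list. [folklore] -/
theorem infix_of_infix_expand (hι : ∀ a b, ∀ x ∈ ι a b, x ∈ VX) {l : List α} (hl : ∀ x ∈ l, x ∉ VX)
    {a b : α} (h : [a, b] <:+: expand ι l) (ha : a ∉ VX) (hb : b ∉ VX) : [a, b] <:+: l := by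
  have := infix_contract_of_infix (VX := VX) h ha hb
  rwa [contract_expand hι hl] at this

omit [DecidableEq α] in
/-- **An expansion has distinct entries** when the list has distinct entries outside `VX` and the
inserted lists are distinct lists inside `VX`, pairwise disjoint for different consecutive pairs.
[folklore] -/
theorem nodup_expand (hι : ∀ a b, ∀ x ∈ ι a b, x ∈ VX) (hιnd : ∀ a b, (ι a b).Nodup) :
    ∀ {l : List α}, l.Nodup → (∀ x ∈ l, x ∉ VX) →
      (∀ a b a' b', [a, b] <:+: l → [a', b'] <:+: l → (a, b) ≠ (a', b') → List.Disjoint (ι a b) (ι a' b')) →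
      (expand ι l).Nodup
  | [], _, _, _ => List.nodup_nil
  | [a], _, _, _ => List.nodup_singleton a
  | a :: b :: l, hnd, hV, hdis => by
    rw [expand_cons_cons, List.nodup_cons, List.mem_append, not_or]
    have ha : a ∉ VX := hV a (by simp)
    have hab : a ∉ b :: l := (List.nodup_cons.1 hnd).1
    have ih : (expand ι (b :: l)).Nodup :=
      nodup_expand hι hιnd (List.nodup_cons.1 hnd).2 (fun x hx => hV x (List.mem_cons_of_mem _ hx))
        fun c d c' d' ⟨s, t, hst⟩ ⟨s', t', hst'⟩ hne =>
          hdis c d c' d' ⟨a :: s, t, by rw [← hst]; simp⟩ ⟨a :: s', t', by rw [← hst']; simp⟩ hne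
    refine ⟨⟨fun h => ha (hι a b a h), fun h => ?_⟩, List.Nodup.append (hιnd a b) ih fun x hx hx' => ?_⟩
    · rcases (mem_expand_iff ι).1 h with h | ⟨c, d, -, h⟩
      · exact hab h
      · exact ha (hι c d a h)
    · rcases (mem_expand_iff ι).1 hx' with h | ⟨c, d, hcd, h⟩
      · exact hV x (List.mem_cons_of_mem _ h) (hι a b x hx)
      · refine hdis a b c d ⟨[], l, rfl⟩ ?_ ?_ hx h
        · obtain ⟨s, t, hst⟩ := hcd
          exact ⟨a :: s, t, by rw [← hst]; simp⟩
        · intro heq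
          obtain ⟨rfl, rfl⟩ := Prod.mk.inj heq
          exact hab (hcd.subset (by simp))

/-- **The segments of an expansion** are exactly the inserted nonempty lists. [folklore] -/
theorem isSeg_expand_iff (hι : ∀ a b, ∀ x ∈ ι a b, x ∈ VX) {l : List α} (hl : ∀ x ∈ l, x ∉ VX)
    (hnd : (expand ι l).Nodup) {a b : α} {xs : List α} :
    IsSeg VX (expand ι l) a xs b ↔ [a, b] <:+: l ∧ ι a b = xs ∧ xs ≠ [] := by
  constructor
  · intro h
    have ha : a ∉ VX := h.2.2.2.1
    -- `a` is an entry of `l`, not the last one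
    have hal : a ∈ l := by
      rcases (mem_expand_iff ι).1 h.mem.1 with hm | ⟨c, d, -, hm⟩
      · exact hm
      · exact absurd (hι c d a hm) ha
    obtain ⟨p, q, hpq⟩ := List.mem_iff_append.1 hal
    rcases q with _ | ⟨b₀, q⟩
    · -- `a` last in `l`, hence last in the expansion: no segment starts at `a`
      exfalso
      obtain ⟨⟨l₁, l₂, hl₁⟩, -⟩ := h
      have hlast : (expand ι l).getLast? = some a := by rw [getLast?_expand, hpq]; simp
      have h1 : (expand ι l).getLast? = (b :: l₂).getLast? := by
        rw [hl₁, show l₁ ++ a :: (xs ++ b :: l₂) = (l₁ ++ a :: xs) ++ (b :: l₂) by simp,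
          List.getLast?_append_of_ne_nil _ (List.cons_ne_nil _ _)]
      rw [h1] at hlast
      have hmem : a ∈ b :: l₂ := List.mem_of_getLast? hlast
      rw [hl₁] at hnd
      exact (List.nodup_cons.1 (List.nodup_append.1 hnd).2.1).1 (List.mem_append_right _ hmem)
    · have hinf : [a, b₀] <:+: l := ⟨p, q, by rw [hpq]; simp⟩
      obtain ⟨E₁, E₂, hE, -⟩ := expand_eq_append_of_infix ι hinf
      have hb₀ : b₀ ∉ VX := hl b₀ (by rw [hpq]; simp)
      by_cases hι0 : ι a b₀ = []
      · -- `a, b₀` consecutive in the expansion: contradicts the segment after `a`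
        exfalso
        obtain ⟨⟨l₁, l₂, hl₁⟩, hne, hxs, -, -⟩ := h
        rw [hι0, List.nil_append] at hE
        obtain ⟨-, htl⟩ := split_unique_of_nodup hnd hl₁ hE
        obtain ⟨y, ys, rfl⟩ := List.exists_cons_of_ne_nil hne
        simp only [List.cons_append, List.cons.injEq] at htl
        exact hb₀ (htl.1 ▸ hxs y (by simp))
      · have hseg : IsSeg VX (expand ι l) a (ι a b₀) b₀ := ⟨⟨E₁, E₂, hE⟩, hι0, hι a b₀, ha, hb₀⟩
        obtain ⟨rfl, rfl⟩ := h.right_unique hnd hseg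
        exact ⟨hinf, rfl, hι0⟩
  · rintro ⟨hinf, rfl, hne⟩
    obtain ⟨E₁, E₂, hE, -⟩ := expand_eq_append_of_infix ι hinf
    exact ⟨⟨E₁, E₂, hE⟩, hne, hι a b, hl a (hinf.subset (by simp)), hl b (hinf.subset (by simp))⟩

/-- **Round trip 2**: expanding the contraction of `l'` by its segments (and by nothing between
entries consecutive in `l'`) gives back `l'`. [folklore] -/
theorem expand_contract : ∀ {l' : List α}, (∀ a ∈ l'.head?, a ∉ VX) → (∀ b ∈ l'.getLast?, b ∉ VX) →
    (∀ a xs b, IsSeg VX l' a xs b → ι a b = xs) →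
    (∀ a b, [a, b] <:+: l' → a ∉ VX → b ∉ VX → ι a b = []) →
    expand ι (contract VX l') = l'
  | [], _, _, _, _ => rfl
  | c :: rest, hhead, hlast, hseg, hcons => by
    have hc : c ∉ VX := hhead c rfl
    have hdec : rest = rest.takeWhile (· ∈ VX) ++ rest.dropWhile (· ∈ VX) :=
      List.takeWhile_append_dropWhile.symm
    have hrunV : ∀ x ∈ rest.takeWhile (· ∈ VX), x ∈ VX := fun x hx => by
      simpa using List.mem_takeWhile_imp hx
    cases hdrop : rest.dropWhile (· ∈ VX) with
    | nil =>
      -- all of `rest` is inside `VX`: then `rest = []`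
      have hall : ∀ y ∈ rest, y ∈ VX := fun y hy => by
        simpa using List.dropWhile_eq_nil_iff.1 hdrop y hy
      rcases rest.eq_nil_or_concat with hr | ⟨r', d, hr'⟩
      · subst hr
        rw [contract_cons_of_not_mem hc, contract_nil, expand_singleton]
      · exfalso
        rw [List.concat_eq_append] at hr'
        have hd : d ∉ VX := hlast d (by
          rw [hr', ← List.cons_append, List.getLast?_append_of_ne_nil _ (List.cons_ne_nil d [])]
          rfl)
        exact hd (hall d (by rw [hr']; simp))
    | cons b rem =>
      have hb : b ∉ VX := by simpa using not_of_dropWhile_eq_cons hdrop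
      rw [hdrop] at hdec
      generalize rest.takeWhile (· ∈ VX) = run at hdec hrunV
      have hlen : (b :: rem).length < (c :: rest).length := by
        rw [hdec]
        simp only [List.length_cons, List.length_append]
        omega
      -- induction hypothesis on `b :: rem`
      have ih : expand ι (contract VX (b :: rem)) = b :: rem := by
        refine expand_contract (fun d hd => by simp at hd; exact hd ▸ hb) (fun d hd => hlast d ?_)
          (fun a xs b' hs => hseg a xs b' ?_) (fun a b' hab ha hb' => hcons a b' ?_ ha hb')
        · rw [hdec, ← List.cons_append, List.getLast?_append_of_ne_nil _ (List.cons_ne_nil b rem)]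
          exact hd
        · rw [hdec]
          simpa using hs.append_left (c :: run)
        · obtain ⟨s, t, hst⟩ := hab
          exact ⟨c :: (run ++ s), t, by rw [hdec, ← hst]; simp⟩
      -- the inserted piece after `c` is the run before `b`
      have hrun : ι c b = run := by
        by_cases hnil : run = []
        · subst hnil
          exact hcons c b ⟨[], rem, by rw [hdec]; rfl⟩ hc hb
        · exact hseg c run b ⟨⟨[], rem, by rw [hdec]; rfl⟩, hnil, hrunV, hc, hb⟩
      rw [hdec, contract_cons_of_not_mem hc, contract_append, contract_eq_nil_of_forall hrunV, List.nil_append,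
        contract_cons_of_not_mem hb, expand_cons_cons, ← contract_cons_of_not_mem hb, ih, hrun]
termination_by l' => l'.length
decreasing_by simp only [List.length_cons] at hlen ⊢; omega

end rounds

end Literature.Combinatorics.SimpleGraph
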